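import Summits.CriticalPhenomena.PercolationContinuityZ3.Theorems.PercNearOneGluingNoHeavyQuantThreeChainForest
import Summits.CriticalPhenomena.PercolationContinuityZ3.Theorems.PercNearOneGluingNoHeavyQuantShapeForest
import Summits.CriticalPhenomena.PercolationContinuityZ3.Theorems.PercNearOneGluingNoHeavyQuantCompSlice
import Summits.CriticalPhenomena.PercolationContinuityZ3.Theorems.PercNearOneGluingNoHeavyQuantForestPerm
import HarnessLib

/-!
# QUANT lane R8, T-DEC: THE NODE `SiblingStep` HOLDS FOR EVERY FOREST OF 3-CHAINS / GLUED CHILDREN AND FOR EVERY FOREST OF GLUED SIBLINGS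
# `R^lo(R^K)` OF ONE SHAPE `lo < K ≤ 3lo/2` — ANY PARAMETERS, EVERY WIDTH, EVERY TREE-OK FLOOR, NO ORACLE (census-1 gen 31: the heavy members by
# the piece expansion, the light members are TAME and are adjoined by arm-1 g57's `sdec_cons_of_tame`)

builds on p205010 (kernel theorem, internal audit signed; external expert review pending)

Support file (`--supports stmt-CriticalPhenomena-4575`), QUANT lane seat prim-quant-census-1 (gen 31); memo
`run/shared/lean/prim/quant/prim-quant-census-1/g31/HUB-GENERAL-G31.md`.  Theorems only (no definitions), standard axioms, no sorries.  Uses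
`sdec_threeChain_forest` (`…QuantThreeChainForest`), `sdec_shapeForest` (`…QuantShapeForest`), arm-1 g57's `sdec_cons_of_tame` (`…QuantCompSlice`),
the permutation invariance `flaw_perm` / `ftop_perm` (`…QuantForestPerm`).

THE POINT.  `sdec_threeChain_forest` / `sdec_shapeForest` assume every sibling HEAVY (`mᵢ ≥ 2`, resp. `mᵢ ≥ 2lo`) — the far-giant regime where the
piece expansion is needed.  A sibling below that threshold has `q·mean ≤ 2·(least charged count)`, i.e. every charged count is LIGHT: it is TAME, and a
tame sibling can be adjoined to ANY SDEC forest (`sdec_cons_of_tame`, COMP-SLICE).  Sorting the tame siblings in front (`flaw` is permutation-invariant)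
removes the threshold:
* `sdec_append_tame` — adjoin a list of tame, affordable, law-OK siblings to an SDEC affordable forest.
* **`sdec_threeChains_all`** — ∀ `L : List Sib`, every sibling `⟨q,·,·,3,{1: 1−p, 2: p(1−t), 3: pt}⟩` with `0 < q, p < 1`, `0 < t ≤ 1` (`t = 1`: the
  glued child `R[q](R²[p])`), at any floor `0 < x ≤ min qᵢpᵢtᵢ`: **`SDEC x (ftop L) (flaw L)`** — EVERY forest of 3-chains and glued children, NO
  parameter restriction: the list form of the node `SiblingStep` holds on this family outright.
* **`sdec_shapeForests_all`** — `lo < K`, `2K ≤ 3lo`; ∀ `L`, every sibling `⟨q,·,·,lo+K,{lo: 1−g, lo+K: g}⟩`, `0 < q, g < 1`, floor `0 < x ≤ min qᵢgᵢ`: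
  **`SDEC x (ftop L) (flaw L)`**.

HONEST STATUS.  Unconditional SDEC families (the node `SiblingStep` on them, oracle-free); the node for ALL tree-OK forests, `GluedDominated'`,
`SDECConvClosed`, `FarTreeRow` OPEN; RATE class (log\*) / honest sentence of `run/shared/lean/prim/quant/README.md` unchanged.  [this work].  Nothing
here is cited as a published result.  The gluing rows served [cite: KozmaNitzan2024, Conjecture 3 (p. 15)]; product measure [cite: Grimmett1999, §1.3 p. 10].
-/

noncomputable section

open scoped BigOperators

namespace Summit.CriticalPhenomena.PercolationContinuityZ3.Theorems
namespace Quant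
namespace LawDec

open Finset

/-- the 3-chain's sub-forest law `{1: 1−p, 2: p(1−s), 3: ps}` -/
local notation3 "CH[" p ", " s "]" => (fun h : ℕ => (1 - (p : ℝ)) * (if h = 1 then (1 : ℝ) else 0) +
  (p : ℝ) * (1 - (s : ℝ)) * (if h = 2 then (1 : ℝ) else 0) + (p : ℝ) * (s : ℝ) * (if h = 3 then (1 : ℝ) else 0))

/-- the sub-forest law of the glued sibling of shape `(lo, K)`: `S(g) = {lo: 1−g, lo+K: g}` -/
local notation3 "SP[" lo ", " K ", " a "]" => (fun h : ℕ => (1 - (a : ℝ)) * (if h = (lo : ℕ) then (1 : ℝ) else 0) +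
  (a : ℝ) * (if h = (lo : ℕ) + (K : ℕ) then (1 : ℝ) else 0))

/-! ### Adjoining tame siblings -/

/-- **adjoin a list of TAME siblings to an SDEC forest** (iterated `sdec_cons_of_tame`). [this work] -/
theorem sdec_append_tame {x : ℝ} (hx0 : 0 < x) (hx1 : x < 1) (Lh : List Sib) (hLh : ∀ t ∈ Lh, t.LawOK)
    (hxLh : ∀ t ∈ Lh, x * (t.M : ℝ) ≤ t.q * t.mean) (hS : SDEC x (ftop Lh) (flaw Lh)) :
    ∀ Lt : List Sib, (∀ s ∈ Lt, s.LawOK) → (∀ s ∈ Lt, x * (s.M : ℝ) ≤ s.q * s.mean) →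
      (∀ s ∈ Lt, ∀ h : ℕ, 1 ≤ h → s.ρ h ≠ 0 → s.q * s.mean ≤ 2 * h ∨ x * ((s.M : ℝ) - h) ≤ s.q * s.mean - h) →
      SDEC x (ftop (Lt ++ Lh)) (flaw (Lt ++ Lh))
  | [], _, _, _ => by simpa using hS
  | s :: Lt, hLt, hxLt, htame => by
    have ih := sdec_append_tame hx0 hx1 Lh hLh hxLh hS Lt (fun t ht => hLt t (List.mem_cons_of_mem s ht))
      (fun t ht => hxLt t (List.mem_cons_of_mem s ht)) (fun t ht => htame t (List.mem_cons_of_mem s ht))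
    have hall : ∀ t ∈ Lt ++ Lh, t.LawOK := by
      intro t ht
      rcases List.mem_append.1 ht with h | h
      · exact hLt t (List.mem_cons_of_mem s h)
      · exact hLh t h
    have hxall : ∀ t ∈ Lt ++ Lh, x * (t.M : ℝ) ≤ t.q * t.mean := by
      intro t ht
      rcases List.mem_append.1 ht with h | h
      · exact hxLt t (List.mem_cons_of_mem s h)
      · exact hxLh t h
    rw [List.cons_append]
    exact sdec_cons_of_tame hx0 hx1 (Lt ++ Lh) s hall hxall ih (hLt s (by simp)) (hxLt s (by simp)) (htame s (by simp))

/-- SDEC along a permutation of the sibling list. [this work] -/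
theorem sdec_flaw_perm {x : ℝ} {L L' : List Sib} (h : L.Perm L') (hS : SDEC x (ftop L) (flaw L)) : SDEC x (ftop L') (flaw L') := by
  rw [← ftop_perm h, ← flaw_perm h]; exact hS

/-! ### Every forest of 3-chains and glued children -/

/-- **EVERY FOREST OF 3-CHAINS AND GLUED CHILDREN IS SDEC AT EVERY TREE-OK FLOOR — ANY PARAMETERS, EVERY WIDTH, NO ORACLE.**  For every list of
siblings `⟨q,·,·,3,{1: 1−p, 2: p(1−t), 3: pt}⟩` with `0 < q, p < 1`, `0 < t ≤ 1`, and every floor `0 < x ≤ min qᵢpᵢtᵢ`: `SDEC x (ftop L) (flaw L)`.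
Heavy siblings (`q(1+p+pt) ≥ 2`) by `sdec_threeChain_forest`, light ones are tame and adjoined by `sdec_cons_of_tame`. [this work] -/
theorem sdec_threeChains_all {x : ℝ} (hx0 : 0 < x) (L : List Sib)
    (hL : ∀ s ∈ L, s.M = 3 ∧ 0 < s.q ∧ s.q < 1 ∧ ∃ p t : ℝ, 0 < p ∧ p < 1 ∧ 0 < t ∧ t ≤ 1 ∧ s.ρ = CH[p, t] ∧ x ≤ s.q * (p * t)) :
    SDEC x (ftop L) (flaw L) := by
  classical
  by_cases hnil : L = []
  · subst hnil; intro q _ _ j' hj'; exact absurd hj' (Nat.not_lt_zero _)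
  obtain ⟨s₀, hs₀⟩ := List.exists_mem_of_ne_nil L hnil
  have hx1 : x < 1 := by
    obtain ⟨_, hq0, hq1, p, t, hp0, hp1, ht0, ht1, _, hx⟩ := hL s₀ hs₀
    have : p * t ≤ p := by nlinarith
    nlinarith
  -- sibling facts
  have facts : ∀ s ∈ L, s.LawOK ∧ s.mean = s.mean ∧ x * (s.M : ℝ) ≤ s.q * s.mean ∧
      (∀ h : ℕ, 1 ≤ h → s.ρ h ≠ 0 → s.q * s.mean < 2 → s.q * s.mean ≤ 2 * h) := by
    intro s hs
    obtain ⟨hM, hq0, hq1, p, t, hp0, hp1, ht0, ht1, hρ, hx⟩ := hL s hs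
    obtain ⟨⟨c0, cM, c1, cm⟩, _⟩ := chain3_laws hq0.le hq1.le hp0.le hp1.le ht0.le ht1
    have hmean : s.mean = 1 + p + p * t := by unfold Sib.mean; rw [hM, hρ]; exact cm
    refine ⟨⟨hq0, hq1, fun h => by rw [hρ]; exact c0 h, fun h hh => by rw [hρ]; exact cM h (by rw [hM] at hh; exact hh),
      by rw [hM, hρ]; exact c1⟩, rfl, ?_, ?_⟩
    · rw [hM, hmean]; push_cast
      have : 0 ≤ s.q * (1 + p - 2 * p * t) := mul_nonneg hq0.le (by nlinarith)
      nlinarith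
    · intro h h1 _ hlt
      have : (1 : ℝ) ≤ h := by exact_mod_cast h1
      linarith
  set b : Sib → Bool := fun s => decide ((2 : ℝ) ≤ s.q * s.mean) with hb
  set Lh := L.filter b with hLh
  set Lt := L.filter (fun s => !b s) with hLt
  have hperm : (Lt ++ Lh).Perm L := (List.perm_append_comm).trans (List.filter_append_perm b L)
  refine sdec_flaw_perm hperm ?_
  have hSh : SDEC x (ftop Lh) (flaw Lh) := by
    refine sdec_threeChain_forest hx0 Lh fun s hs => ?_
    have hsL : s ∈ L := List.mem_of_mem_filter hs
    have hbs : (2 : ℝ) ≤ s.q * s.mean := by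
      have := (List.mem_filter.1 hs).2
      simpa [hb] using this
    obtain ⟨hM, hq0, hq1, p, t, hp0, hp1, ht0, ht1, hρ, hx⟩ := hL s hsL
    obtain ⟨⟨_, _, _, cm⟩, _⟩ := chain3_laws hq0.le hq1.le hp0.le hp1.le ht0.le ht1
    have hmean : s.mean = 1 + p + p * t := by unfold Sib.mean; rw [hM, hρ]; exact cm
    exact ⟨hM, hq0, hq1, p, t, hp0, hp1, ht0, ht1, hρ, by rw [← hmean]; exact hbs, hx⟩
  refine sdec_append_tame hx0 hx1 Lh (fun t ht => (facts t (List.mem_of_mem_filter ht)).1)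
    (fun t ht => (facts t (List.mem_of_mem_filter ht)).2.2.1) hSh Lt (fun s hs => (facts s (List.mem_of_mem_filter hs)).1)
    (fun s hs => (facts s (List.mem_of_mem_filter hs)).2.2.1) ?_
  intro s hs h h1 hh
  have hsL : s ∈ L := List.mem_of_mem_filter hs
  have hbs : s.q * s.mean < 2 := by
    have := (List.mem_filter.1 hs).2
    simp [hb] at this
    exact this
  exact Or.inl ((facts s hsL).2.2.2 h h1 hh hbs)

/-! ### Every forest of glued siblings of one shape -/

/-- **EVERY FOREST OF GLUED SIBLINGS `R^lo(R^K)` OF ONE SHAPE `lo < K ≤ 3lo/2` IS SDEC AT EVERY TREE-OK FLOOR — ANY PARAMETERS, EVERY WIDTH, NO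
ORACLE.**  For every list of siblings `⟨q,·,·,lo+K,{lo: 1−g, lo+K: g}⟩` with `0 < q, g < 1` and every floor `0 < x ≤ min qᵢgᵢ`: `SDEC x (ftop L) (flaw L)`.
Heavy siblings (`q(lo+Kg) ≥ 2lo`) by `sdec_shapeForest`, light ones are tame. [this work] -/
theorem sdec_shapeForests_all (lo K : ℕ) (hloK : lo < K) (hK32 : 2 * K ≤ 3 * lo) {x : ℝ} (hx0 : 0 < x) (L : List Sib)
    (hL : ∀ s ∈ L, s.M = lo + K ∧ 0 < s.q ∧ s.q < 1 ∧ ∃ g : ℝ, 0 < g ∧ g < 1 ∧ s.ρ = SP[lo, K, g] ∧ x ≤ s.q * g) :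
    SDEC x (ftop L) (flaw L) := by
  classical
  by_cases hnil : L = []
  · subst hnil; intro q _ _ j' hj'; exact absurd hj' (Nat.not_lt_zero _)
  obtain ⟨s₀, hs₀⟩ := List.exists_mem_of_ne_nil L hnil
  have hx1 : x < 1 := by
    obtain ⟨_, hq0, hq1, g, hg0, hg1, _, hx⟩ := hL s₀ hs₀
    nlinarith
  have hlo : 1 ≤ lo := by omega
  have hloR : (1 : ℝ) ≤ lo := by exact_mod_cast hlo
  have facts : ∀ s ∈ L, s.LawOK ∧ x * (s.M : ℝ) ≤ s.q * s.mean ∧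
      (∀ h : ℕ, 1 ≤ h → s.ρ h ≠ 0 → s.q * s.mean < 2 * lo → s.q * s.mean ≤ 2 * h) := by
    intro s hs
    obtain ⟨hM, hq0, hq1, g, hg0, hg1, hρ, hx⟩ := hL s hs
    obtain ⟨c0, cM, c1, cm⟩ := sp_laws lo K hg0.le hg1.le
    have hmean : s.mean = (lo : ℝ) + K * g := by unfold Sib.mean; rw [hM, hρ]; exact cm
    refine ⟨⟨hq0, hq1, fun h => by rw [hρ]; exact c0 h, fun h hh => by rw [hρ]; exact cM h (by rw [hM] at hh; exact hh),
      by rw [hM, hρ]; exact c1⟩, ?_, ?_⟩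
    · rw [hM, hmean]; push_cast
      have hB : (0 : ℝ) ≤ (lo : ℝ) + K := by positivity
      have h1 := mul_le_mul_of_nonneg_right hx hB
      have h2 : 0 ≤ s.q * (lo : ℝ) * (1 - g) := mul_nonneg (mul_nonneg hq0.le (Nat.cast_nonneg lo)) (by linarith)
      nlinarith
    · intro h _ hh hlt
      have hat : h = lo ∨ h = lo + K := by
        by_contra hc
        push Not at hc
        apply hh; rw [hρ]; dsimp only; rw [if_neg hc.1, if_neg hc.2]; ring
      have : (lo : ℝ) ≤ h := by
        rcases hat with rfl | rfl
        · exact le_rfl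
        · push_cast; linarith [(Nat.cast_nonneg K : (0 : ℝ) ≤ K)]
      linarith
  set b : Sib → Bool := fun s => decide (2 * (lo : ℝ) ≤ s.q * s.mean) with hb
  set Lh := L.filter b with hLh
  set Lt := L.filter (fun s => !b s) with hLt
  have hperm : (Lt ++ Lh).Perm L := (List.perm_append_comm).trans (List.filter_append_perm b L)
  refine sdec_flaw_perm hperm ?_
  have hSh : SDEC x (ftop Lh) (flaw Lh) := by
    refine sdec_shapeForest lo K hloK hK32 hx0 Lh fun s hs => ?_
    have hsL : s ∈ L := List.mem_of_mem_filter hs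
    have hbs : 2 * (lo : ℝ) ≤ s.q * s.mean := by
      have := (List.mem_filter.1 hs).2
      simpa [hb] using this
    obtain ⟨hM, hq0, hq1, g, hg0, hg1, hρ, hx⟩ := hL s hsL
    obtain ⟨_, _, _, cm⟩ := sp_laws lo K hg0.le hg1.le
    have hmean : s.mean = (lo : ℝ) + K * g := by unfold Sib.mean; rw [hM, hρ]; exact cm
    exact ⟨hM, hq0, hq1, g, hg0, hg1, hρ, by rw [← hmean]; exact hbs, hx⟩
  refine sdec_append_tame hx0 hx1 Lh (fun t ht => (facts t (List.mem_of_mem_filter ht)).1)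
    (fun t ht => (facts t (List.mem_of_mem_filter ht)).2.1) hSh Lt (fun s hs => (facts s (List.mem_of_mem_filter hs)).1)
    (fun s hs => (facts s (List.mem_of_mem_filter hs)).2.1) ?_
  intro s hs h h1 hh
  have hsL : s ∈ L := List.mem_of_mem_filter hs
  have hbs : s.q * s.mean < 2 * lo := by
    have := (List.mem_filter.1 hs).2
    simp [hb] at this
    exact this
  exact Or.inl ((facts s hsL).2.2 h h1 hh hbs)

end LawDec
end Quant
end Summit.CriticalPhenomena.PercolationContinuityZ3.Theorems
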